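import Literature.AnabelianGeometry.EtaleTheta.ArithThetaTowerCThetaUnits
import Literature.AlgebraicGeometry.Frobenioids.BiratUnitsIntertwines
import Literature.AlgebraicGeometry.Frobenioids.ModelFrobenioidComparisonCocycle
import HarnessLib

/-!
# [IUTchI] Ex. 3.2 (v) at the ARITHMETIC theta tower: the functor `𝒞^Θ_v → ℱ÷_v = ℱ̲_v^birat` (DATA) and the data-first
# rest input `thetaRestBiratData` (GAP A item GA-06, FIELDS half of D6, file 3/3)

S. Mochizuki, *Inter-universal Teichmüller Theory I* [Mochizuki2012], Ex. 3.2 (v) p.72: «`𝒪^▷_{𝒞^Θ_v}(−)` determines … a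
`p_v`-adic Frobenioid with base category given by `𝒟^Θ_v` [cf. [FrdII], Example 1.1, (ii)] `𝒞^Θ_v (⊆ ℱ÷_v)` — which may be
thought of as a subcategory of `ℱ÷_v`» [claim: Mochizuki2012, status: disputed] (D-0012 claim key; a CONSTRUCTION over OUR typed
objects; nothing of the series asserted); [MochizukiFrdI2008] Thm. 5.2 (i)(ii) p.100–101 (the model Frobenioid; «`B` is the
rational function monoid», the tree's `RationalFunctionMonoidStr.natural`), Def. 4.5 (i) p.86 / Def. 1.2 (iv) (birational
Frobenius-normalisation, the tree's `ModelFrobenioid.isBiratFrobeniusNormalizedObj`), Prop. 4.4 (iv) p.83 (`𝒪^×(A^birat) →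
Aut(A^birat)`, `BiratUnits.toHom`).  Ruled shape: GAP-A-SIGNATURES v1 §5 D6; RULINGS #341 (B) (SIG-DELTA `(l : ℕ)` after `(hq)`).

THE FUNCTOR `cThetaToBirat hC hF hq : 𝒞^Θ_v ⥤ ℱ÷_v`.  `𝒞^Θ_v = T.CTheta d hq` is the MODEL Frobenioid of `BadLocalGroupDatum.thetaDatum`
over `𝒟^Θ_v`; a morphism `φ : (A^Θ, α) → (B^Θ, β)` is `(deg_Fr φ = d, Base φ = f, Div φ = n·log q̲_v, u_φ ∈ B_{𝒞^Θ_v}(A^Θ))` and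
factors as `F(d) ≫ (1, f, n·log q̲_v, u_φ)` ([FrdI] Thm. 5.2 (i)).  It is sent to
`toBirat(F(d)_{Ÿ_T × A}) ≫ toHom(unitPart u_φ) ≫ toBirat(pull-back along Ÿ_T × f) : T^÷_{Ÿ_T × A} → T^÷_{Ÿ_T × B}`, where `unitPart`
(file 2/3) reads `u_φ = u · q̲_v^n` as the birational unit `u · Θ̲_v^n|_{Ÿ_T × A}` — print's «`q̲_v|_{T_A} ↦ Θ̲_v|_{T_{A^Θ}}`».
FUNCTORIALITY is PROVED from three laws in `ℱ̲_v`/`ℱ÷_v`: (L1) pull-backs commute with `F(d)` on Frobenius-trivial objects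
(`pbAt_frobAt`, in `ℱ̲_v`); (L2) birational Frobenius-normalisation `u ≫ F(d) = F(d) ≫ u^d` (`toHom_comp_frobAt`; [FrdI] Thm. 5.2
(ii) via abc-iut-L1's `isBiratFrobeniusNormalizedObj`, the `unit_comp_frob` pattern); (L3) linear intertwining `pb ≫ v = f^*v ≫ pb`
(`toBirat_pbAt_comp_toHom`; [FrdI] Thm. 5.2 (ii) «Moreover» = `RationalFunctionMonoidStr.natural` + `intertwines_iff_toHom_comm`);
plus `unitPart_natural` (file 2/3).  Then **`thetaRestBiratData hC hF hq l : ThetaRestBiratData d T C hF hq`** :=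
`⟨theta hC hF, lZ hC l, constUnits hC hF, cThetaToBirat hC hF hq⟩`; GA-16 lands `thetaRestBirat_of_carrierSpec … :=
(thetaRestBiratData hC hF hq l).toRestBirat (GA-13's CdashToC …) …` after proving `CThetaToBirat` faithful and over `𝒟^Θ_v → 𝒟_v`
(on objects `cThetaToBirat` IS `A^Θ ↦ T^÷_{Ÿ_T × A}` over `(T.dThetaIncl.obj A^Θ).left` ON THE NOSE: `cThetaToBirat_obj`).
`lZ` PRECISION (keeper-A 21:19:22Z): `lZ hC l` = «l·Aut_{𝒟_v}(Ÿ_T)» is print's `l·ℤ` exactly when `Aut_{𝒟_v}(Ÿ_T) ≅ ℤ`; for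
`Aut ≅ ℤ × μ₂` and `l` odd it is `l·ℤ × μ₂` (the `μ₂` rides along) — the FINITE/LABELLED avatar, FOUNDATIONS 13 U2; no slot law
consumes `lZ`.
carrier: genuine-by-[EtTh]-recipe on the T-lattice (Ÿ_T, Ÿ_T × V, X̲̲_v̲ × V) + constants everywhere; off-lattice Φ via
`rebase`/pullback; [EtTh] Def 3.3 Φ at general U and print's Ÿ̈/μ_N Kummer levels = FOUNDATIONS 13/14, not claimed (#322
(c3′); this file defines no carrier).  HONEST FRAMING: DATA (a functor, with its functoriality proved) over a `Prop`-valued spec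
at OUR typed objects; TYPED ≠ INHABITED (the term is GA-12's) ≠ proved-in-print; faithfulness is GA-16's, NOT claimed here; an
UNDISPUTED construction around [IUTchIII] Cor. 3.12, which stays OPEN by charter (D-0045) — no side taken; nothing here asserts
abc proved or refuted; count-neutral.  No instance, no notation, no `sorry`.
-/

noncomputable section

namespace Literature.AnabelianGeometry.EtaleTheta

namespace ArithThetaTower

open CategoryTheory Opposite Function Literature.AlgebraicGeometry.Frobenioids Literature.AnabelianGeometry.SemiGraphs
  Literature.IUT.HodgeTheaters Literature.AlgebraicGeometry.Frobenioids.PadicFrd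

variable {p : ℕ} [Fact p.Prime] {d : GaloisValDatum.{0} p} {P : Type} [Group P] [TopologicalSpace P]
  {T : BadLocalGroupDatum d.Gal P} {T' : RealifiedDivisorMonoids (D₀ := T.Dv) treeMonoidVocabWeak.{0}}
  {VD : FrdICatStub.{0, 0, 0} T.Dv}

section Frobenioid

variable (C : TemperedFrobenioid T' T.Dv VD)

/-- **`F(n)_A : T_A → T_A`**, the base-identity endomorphism `(deg n, id, Div 0, u 1)` of the Frobenius-trivial object `T_A = (A, 0)` of
the tempered Frobenioid ([FrdI] Thm. 5.2 (i); the Frobenius part of a morphism). [cite: MochizukiFrdI2008, Thm. 5.2 (i) p.100] -/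
def frobAt (A : T.Dv) (n : ℕ+) : (⟨A, 1⟩ : C.category) ⟶ ⟨A, 1⟩ :=
  ⟨n, 𝟙 A, 1, 1, by rw [one_pow, map_one, map_one, map_one]⟩

/-- **`T_A → T_B` over `g : A → B`**, the linear morphism `(deg 1, g, Div 0, u 1)` between Frobenius-trivial objects (the pull-back part).
[cite: MochizukiFrdI2008, Thm. 5.2 (i) p.100] -/
def pbAt {A B : T.Dv} (g : A ⟶ B) : (⟨A, 1⟩ : C.category) ⟶ ⟨B, 1⟩ :=
  ⟨1, g, 1, 1, by rw [one_pow, map_one, map_one, map_one]⟩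

/-- `F(1) = id`. [cite: MochizukiFrdI2008, Thm. 5.2 (i) p.100] -/
theorem frobAt_one (A : T.Dv) : frobAt C A 1 = 𝟙 _ := rfl

/-- The pull-back part over the identity is the identity. [cite: MochizukiFrdI2008, Thm. 5.2 (i) p.100] -/
theorem pbAt_id (A : T.Dv) : pbAt C (𝟙 A) = 𝟙 _ := rfl

/-- The pull-back part is functorial. [cite: MochizukiFrdI2008, Thm. 5.2 (i) p.100] -/
theorem pbAt_comp {A B B' : T.Dv} (g : A ⟶ B) (g' : B ⟶ B') : pbAt C (g ≫ g') = pbAt C g ≫ pbAt C g' := by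
  refine ModelFrobenioid.hom_ext (mul_one 1).symm rfl ?_ ?_
  · change (1 : (C.divisorMonoid.obj (op A) : Type)) = (C.divisorMonoid.map g.op).hom 1 * 1 ^ ((1 : ℕ+) : ℕ)
    rw [map_one, one_pow, mul_one]
  · change (1 : (C.ratFnFunctor.obj (op A) : Type)) = (C.ratFnFunctor.map g.op).hom 1 * 1 ^ ((1 : ℕ+) : ℕ)
    rw [map_one, one_pow, mul_one]

/-- `F(n·m) = F(m) ≫ F(n)`. [cite: MochizukiFrdI2008, Thm. 5.2 (i) p.100] -/
theorem frobAt_mul (A : T.Dv) (m n : ℕ+) : frobAt C A (n * m) = frobAt C A m ≫ frobAt C A n := by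
  refine ModelFrobenioid.hom_ext rfl (Category.id_comp _).symm ?_ ?_
  · change (1 : (C.divisorMonoid.obj (op A) : Type)) = (C.divisorMonoid.map (𝟙 A).op).hom 1 * 1 ^ (n : ℕ)
    rw [map_one, one_pow, mul_one]
  · change (1 : (C.ratFnFunctor.obj (op A) : Type)) = (C.ratFnFunctor.map (𝟙 A).op).hom 1 * 1 ^ (n : ℕ)
    rw [map_one, one_pow, mul_one]

/-- **(L1)** pull-backs commute with the Frobenius endomorphisms of the Frobenius-trivial objects: `pb_g ≫ F(n)_B = F(n)_A ≫ pb_g`.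
[cite: MochizukiFrdI2008, Thm. 5.2 (i) p.100] -/
theorem pbAt_frobAt {A B : T.Dv} (g : A ⟶ B) (n : ℕ+) : pbAt C g ≫ frobAt C B n = frobAt C A n ≫ pbAt C g := by
  refine ModelFrobenioid.hom_ext ((mul_one n).trans (one_mul n).symm)
    ((Category.comp_id g).trans (Category.id_comp g).symm) ?_ ?_
  · change (C.divisorMonoid.map g.op).hom 1 * (1 : (C.divisorMonoid.obj (op A) : Type)) ^ (n : ℕ) =
      (C.divisorMonoid.map (𝟙 A).op).hom 1 * 1 ^ ((1 : ℕ+) : ℕ)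
    rw [map_one, map_one, one_pow, one_pow]
  · change (C.ratFnFunctor.map g.op).hom 1 * (1 : (C.ratFnFunctor.obj (op A) : Type)) ^ (n : ℕ) =
      (C.ratFnFunctor.map (𝟙 A).op).hom 1 * 1 ^ ((1 : ℕ+) : ℕ)
    rw [map_one, map_one, one_pow, one_pow]

variable (hF : PreFrobenioid.IsFrobenioid C.toElem)

/-- Every object of an [EtTh] tempered Frobenioid which is a Frobenioid is birationally Frobenius-normalized ([FrdI] Thm. 5.2 (ii),
abc-iut-L1's `ModelFrobenioid.isBiratFrobeniusNormalizedObj`; `Φ` integral since divisorial by `hF`, `B` group-like).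
[cite: MochizukiFrdI2008, Thm. 5.2 (ii) p.101] -/
theorem isBiratFrobeniusNormalized (A : C.category) :
    PreFrobenioid.IsBiratFrobeniusNormalized C.toElem hF (PreFrobenioid.hasBiratSquares_of_isFrobenioid hF) A :=
  PreFrobenioid.Birat.isBiratFrobeniusNormalized_of_obj hF _ A
    (ModelFrobenioid.isBiratFrobeniusNormalizedObj C.divisorMonoid C.ratFnFunctor C.divBNatTrans hF _
      (fun X => isIntegral_iff_isCancelMul.mp (hF.isPreFrobenioid.isDivisorial X).isPreDivisorial.isIntegral)
      C.objectwise_isGroupLike_weak A)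

/-- **(L2) birational Frobenius-normalisation in action**: `u ≫ F(n)_A^÷ = F(n)_A^÷ ≫ u^n` in `ℱ÷_v` for a unit `u ∈ 𝒪^×(T^÷_A)` (the
`unit_comp_frob` pattern of abc-iut-L1). [cite: MochizukiFrdI2008, Def. 4.5 (i) p.86] -/
theorem toHom_comp_frobAt (A : T.Dv) (u : PreFrobenioid.BiratUnits C.toElem hF (⟨A, 1⟩ : C.category)) (n : ℕ+) :
    PreFrobenioid.BiratUnits.toHom (PreFrobenioid.hasBiratSquares_of_isFrobenioid hF) u ≫
        (PreFrobenioid.toBirat C.toElem hF (PreFrobenioid.hasBiratSquares_of_isFrobenioid hF)).map (frobAt C A n) =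
      (PreFrobenioid.toBirat C.toElem hF (PreFrobenioid.hasBiratSquares_of_isFrobenioid hF)).map (frobAt C A n) ≫
        PreFrobenioid.BiratUnits.toHom (PreFrobenioid.hasBiratSquares_of_isFrobenioid hF) (u ^ (n : ℕ)) := by
  set hsq := PreFrobenioid.hasBiratSquares_of_isFrobenioid hF
  have hγb : PreFrobenioid.IsBaseIdentity (PreFrobenioid.Birat.toElemGp hF hsq)
      ((PreFrobenioid.toBirat C.toElem hF hsq).map (frobAt C A n)) := by
    change PreFrobenioid.Birat.gpBase ((PreFrobenioid.toBirat C.toElem hF hsq).map (frobAt C A n)) = 𝟙 _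
    rw [PreFrobenioid.Birat.gpBase_map]
    rfl
  have hdeg : PreFrobenioid.degFr (PreFrobenioid.Birat.toElemGp hF hsq)
      ((PreFrobenioid.toBirat C.toElem hF hsq).map (frobAt C A n)) = n := rfl
  set α : CategoryTheory.End ((PreFrobenioid.toBirat C.toElem hF hsq).obj (⟨A, 1⟩ : C.category)) :=
    PreFrobenioid.BiratUnits.toHom hsq u with hα
  have hpow : ∀ m : ℕ, (α ^ m : CategoryTheory.End ((PreFrobenioid.toBirat C.toElem hF hsq).obj (⟨A, 1⟩ : C.category))) =
      PreFrobenioid.BiratUnits.toHom hsq (u ^ m) := by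
    intro m
    induction m with
    | zero => rw [pow_zero, pow_zero, PreFrobenioid.BiratUnits.toHom_one]; rfl
    | succ m ih => rw [pow_succ, pow_succ, PreFrobenioid.BiratUnits.toHom_mul, ← ih, CategoryTheory.End.mul_def]
  have h := isBiratFrobeniusNormalized C hF ⟨A, 1⟩ ((PreFrobenioid.toBirat C.toElem hF hsq).map (frobAt C A n)) hγb α
    (PreFrobenioid.FPPath.toHom_mem_endSubmonoid u)
  rw [hdeg] at h
  change (PreFrobenioid.toBirat C.toElem hF hsq).map (frobAt C A n) ≫ (α ^ (n : ℕ)) = α ≫ _ at h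
  rw [hpow] at h
  exact h.symm

/-- **(L3) linear intertwining**: `pb_g^÷ ≫ v = (g^* v) ≫ pb_g^÷` in `ℱ÷_v` for `v ∈ B(B) ≅ 𝒪^×(T^÷_B)` — [FrdI] Thm. 5.2 (ii) «`B` is
the rational function monoid» (naturality of abc-iut-L1's `rationalFunctionMonoidStr` along the linear `pb_g`).
[cite: MochizukiFrdI2008, Thm. 5.2 (ii) p.101] -/
theorem toBirat_pbAt_comp_toHom {A B : T.Dv} (g : A ⟶ B) (b : C.ratFnFunctor.obj (op B)) :
    (PreFrobenioid.toBirat C.toElem hF (PreFrobenioid.hasBiratSquares_of_isFrobenioid hF)).map (pbAt C g) ≫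
        PreFrobenioid.BiratUnits.toHom (PreFrobenioid.hasBiratSquares_of_isFrobenioid hF)
          (BadLocalFrobenioid.temperedRatFnEquivBiratUnits C hF B b) =
      PreFrobenioid.BiratUnits.toHom (PreFrobenioid.hasBiratSquares_of_isFrobenioid hF)
          (BadLocalFrobenioid.temperedRatFnEquivBiratUnits C hF A ((C.ratFnFunctor.map g.op).hom b)) ≫
        (PreFrobenioid.toBirat C.toElem hF (PreFrobenioid.hasBiratSquares_of_isFrobenioid hF)).map (pbAt C g) :=
  ((PreFrobenioid.BiratUnits.intertwines_iff_toHom_comm _ _ _ _).mp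
    ((ModelFrobenioid.rationalFunctionMonoidStr C.objectwise_isGroupLike_weak hF.isPreFrobenioid.isDivisorial hF).natural
      (pbAt C g) rfl b)).symm

end Frobenioid

/-! ## The functor `𝒞^Θ_v → ℱ÷_v` -/

section Functor

variable {C : TemperedFrobenioid T' T.Dv VD} {qroot : intNonzero d.k} (hC : CarrierSpec d T C)
  (hF : PreFrobenioid.IsFrobenioid C.toElem) (hq : ¬ IsUnit qroot)

/-- `F(n)^÷_{Ÿ_T × A}` in `ℱ÷_v` (the Frobenius part at `A^Θ`). ([IUTchI] Ex 3.2 (v) p.72) [claim: Mochizuki2012, status: disputed] -/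
abbrev frobB (X : T.DTheta) (n : ℕ+) :
    (PreFrobenioid.toBirat C.toElem hF (PreFrobenioid.hasBiratSquares_of_isFrobenioid hF)).obj ⟨dThetaObj T X, 1⟩ ⟶
      (PreFrobenioid.toBirat C.toElem hF (PreFrobenioid.hasBiratSquares_of_isFrobenioid hF)).obj ⟨dThetaObj T X, 1⟩ :=
  (PreFrobenioid.toBirat C.toElem hF _).map (frobAt C (dThetaObj T X) n)

/-- `(pull-back over Ÿ_T × f)^÷` in `ℱ÷_v` (the pull-back part). ([IUTchI] Ex 3.2 (v) p.72) [claim: Mochizuki2012, status: disputed] -/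
abbrev pbB {X Y : T.DTheta} (f : X ⟶ Y) :
    (PreFrobenioid.toBirat C.toElem hF (PreFrobenioid.hasBiratSquares_of_isFrobenioid hF)).obj ⟨dThetaObj T X, 1⟩ ⟶
      (PreFrobenioid.toBirat C.toElem hF (PreFrobenioid.hasBiratSquares_of_isFrobenioid hF)).obj ⟨dThetaObj T Y, 1⟩ :=
  (PreFrobenioid.toBirat C.toElem hF _).map (pbAt C (dThetaHom T f))

/-- The unit part of a morphism of `𝒞^Θ_v` as an endomorphism of `T^÷_{Ÿ_T × A}`: `unitPart` (file 2/3) through [FrdI] Thm. 5.2 (ii)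
`B(Ÿ_T × A) ≃* 𝒪^×(T^÷_{Ÿ_T × A})` and Prop. 4.4 (iv) `𝒪^× → Aut`. ([IUTchI] Ex 3.2 (v) p.72) [claim: Mochizuki2012, status: disputed] -/
abbrev unitB (X : T.DTheta) (u : ((T.thetaDatum d hq).B.obj (op X) : Type)) :
    (PreFrobenioid.toBirat C.toElem hF (PreFrobenioid.hasBiratSquares_of_isFrobenioid hF)).obj ⟨dThetaObj T X, 1⟩ ⟶
      (PreFrobenioid.toBirat C.toElem hF (PreFrobenioid.hasBiratSquares_of_isFrobenioid hF)).obj ⟨dThetaObj T X, 1⟩ :=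
  PreFrobenioid.BiratUnits.toHom _ (BadLocalFrobenioid.temperedRatFnEquivBiratUnits C hF (dThetaObj T X)
    (unitPart d T hq hC X u : C.ratFnFunctor.obj (op (dThetaObj T X))))

/-- (L1) in `ℱ÷_v`. ([IUTchI] Ex 3.2 (v) p.72) [claim: Mochizuki2012, status: disputed] -/
theorem pbB_frobB {X Y : T.DTheta} (f : X ⟶ Y) (n : ℕ+) : pbB hF f ≫ frobB hF Y n = frobB hF X n ≫ pbB hF f := by
  change (PreFrobenioid.toBirat C.toElem hF _).map _ ≫ (PreFrobenioid.toBirat C.toElem hF _).map _ =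
    (PreFrobenioid.toBirat C.toElem hF _).map _ ≫ (PreFrobenioid.toBirat C.toElem hF _).map _
  rw [← CategoryTheory.Functor.map_comp, pbAt_frobAt, CategoryTheory.Functor.map_comp]

/-- The unit part is multiplicative: `unitB (a · b) = unitB b ≫ unitB a`. ([IUTchI] Ex 3.2 (v) p.72) [claim: Mochizuki2012, status: disputed] -/
theorem unitB_mul (X : T.DTheta) (a b : ((T.thetaDatum d hq).B.obj (op X) : Type)) :
    unitB hC hF hq X (a * b) = unitB hC hF hq X b ≫ unitB hC hF hq X a := by
  change PreFrobenioid.BiratUnits.toHom _ _ = _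
  rw [map_mul, Units.val_mul, map_mul, PreFrobenioid.BiratUnits.toHom_mul]

/-- The unit part on powers. ([IUTchI] Ex 3.2 (v) p.72) [claim: Mochizuki2012, status: disputed] -/
theorem unitB_pow (X : T.DTheta) (a : ((T.thetaDatum d hq).B.obj (op X) : Type)) (n : ℕ) :
    unitB hC hF hq X (a ^ n) = PreFrobenioid.BiratUnits.toHom _
      (BadLocalFrobenioid.temperedRatFnEquivBiratUnits C hF (dThetaObj T X)
        (unitPart d T hq hC X a : C.ratFnFunctor.obj (op (dThetaObj T X))) ^ n) := by
  change PreFrobenioid.BiratUnits.toHom _ _ = _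
  rw [map_pow, Units.val_pow_eq_pow_val, map_pow]

/-- The unit part is natural: (L3) for `unitB`. ([IUTchI] Ex 3.2 (v) p.72) [claim: Mochizuki2012, status: disputed] -/
theorem pbB_unitB {X Y : T.DTheta} (f : X ⟶ Y) (u : ((T.thetaDatum d hq).B.obj (op Y) : Type)) :
    pbB hF f ≫ unitB hC hF hq Y u = unitB hC hF hq X (((T.thetaDatum d hq).B.map f.op).hom u) ≫ pbB hF f := by
  change _ = PreFrobenioid.BiratUnits.toHom _ (BadLocalFrobenioid.temperedRatFnEquivBiratUnits C hF (dThetaObj T X)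
    (unitPart d T hq hC X (((T.thetaDatum d hq).B.map f.op).hom u) : C.ratFnFunctor.obj (op (dThetaObj T X)))) ≫ _
  rw [unitPart_natural, Units.coe_map]
  exact toBirat_pbAt_comp_toHom C hF (dThetaHom T f) _

/-- (L2) for `unitB`. ([IUTchI] Ex 3.2 (v) p.72) [claim: Mochizuki2012, status: disputed] -/
theorem unitB_frobB (X : T.DTheta) (u : ((T.thetaDatum d hq).B.obj (op X) : Type)) (n : ℕ+) :
    unitB hC hF hq X u ≫ frobB hF X n = frobB hF X n ≫ unitB hC hF hq X (u ^ (n : ℕ)) := by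
  rw [unitB_pow]
  exact toHom_comp_frobAt C hF (dThetaObj T X) _ n

/-- **The composition law** behind the functoriality of `𝒞^Θ_v → ℱ÷_v`: for composable `(d, f, u)`, `(d′, f′, u′)` the images compose
([FrdI] Thm. 5.2 (i) composition `(d′d, f ≫ f′, f^*u′ · u^{d′})`; (L1), (L2), (L3)). ([IUTchI] Ex 3.2 (v) p.72) [claim: Mochizuki2012, status: disputed] -/
theorem frobB_unitB_pbB_comp {X Y Z : T.DTheta} (m n : ℕ+) (f : X ⟶ Y) (f' : Y ⟶ Z)
    (u : ((T.thetaDatum d hq).B.obj (op X) : Type)) (u' : ((T.thetaDatum d hq).B.obj (op Y) : Type)) :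
    frobB hF X (n * m) ≫ unitB hC hF hq X (((T.thetaDatum d hq).B.map f.op).hom u' * u ^ (n : ℕ)) ≫ pbB hF (f ≫ f') =
      (frobB hF X m ≫ unitB hC hF hq X u ≫ pbB hF f) ≫ (frobB hF Y n ≫ unitB hC hF hq Y u' ≫ pbB hF f') := by
  have h1 : frobB hF X (n * m) = frobB hF X m ≫ frobB hF X n := by
    change (PreFrobenioid.toBirat C.toElem hF _).map _ = (PreFrobenioid.toBirat C.toElem hF _).map _ ≫ _
    rw [← CategoryTheory.Functor.map_comp, ← frobAt_mul]
  have h2 : pbB hF (f ≫ f') = pbB hF f ≫ pbB hF f' := by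
    change (PreFrobenioid.toBirat C.toElem hF _).map _ = (PreFrobenioid.toBirat C.toElem hF _).map _ ≫ _
    rw [← CategoryTheory.Functor.map_comp, ← pbAt_comp, ← dThetaHom_comp]
  rw [h1, h2, unitB_mul]
  simp only [Category.assoc]
  rw [reassoc_of% (pbB_frobB hF f n), reassoc_of% (unitB_frobB hC hF hq X u n), reassoc_of% (pbB_unitB hC hF hq f u')]

/-- **THE FUNCTOR `𝒞^Θ_v → ℱ÷_v = ℱ̲_v^birat` (DATA of the slot field `CThetaToBirat`)**: objects `(A^Θ, α) ↦ T^÷_{Ÿ_T × A}`; a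
morphism `φ = F(d) ≫ (1, f, n·log q̲_v, u_φ)` goes to `F(d)^÷_{Ÿ_T × A} ≫ (u · Θ̲_v^n|_{Ÿ_T × A}) ≫ (pull-back over Ÿ_T × f)^÷`
(`toBirat` BY NAME; «`𝒞^Θ_v ⊆ ℱ÷_v`», «`q̲_v|_{T_A} ↦ Θ̲_v|_{T_{A^Θ}}`»).  Functoriality PROVED (`frobB_unitB_pbB_comp`); faithfulness
and the base compatibility are GA-16's. ([IUTchI] Ex 3.2 (v) p.72) [claim: Mochizuki2012, status: disputed] -/
def cThetaToBirat : T.CTheta d hq ⥤ PreFrobenioid.Birat C.toElem hF (PreFrobenioid.hasBiratSquares_of_isFrobenioid hF) where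
  obj X := (PreFrobenioid.toBirat C.toElem hF (PreFrobenioid.hasBiratSquares_of_isFrobenioid hF)).obj ⟨dThetaObj T X.base, 1⟩
  map {X Y} φ := frobB hF X.base (ModelFrobenioid.degFr φ) ≫ unitB hC hF hq X.base (ModelFrobenioid.unit φ) ≫
    pbB hF (ModelFrobenioid.baseMap φ)
  map_id X := by
    rw [ModelFrobenioid.degFr_id, ModelFrobenioid.unit_id, ModelFrobenioid.baseMap_id]
    change (PreFrobenioid.toBirat C.toElem hF _).map _ ≫ PreFrobenioid.BiratUnits.toHom _ _ ≫
      (PreFrobenioid.toBirat C.toElem hF _).map _ = _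
    rw [frobAt_one, map_one, Units.val_one, map_one, dThetaHom_id, pbAt_id, CategoryTheory.Functor.map_id,
      PreFrobenioid.BiratUnits.toHom_one, Category.id_comp, Category.id_comp]
  map_comp φ ψ := frobB_unitB_pbB_comp hC hF hq _ _ _ _ _ _

/-- `cThetaToBirat` on objects IS `A^Θ ↦ T^÷_{Ÿ_T × A}`, `Ÿ_T × A = (T.dThetaIncl.obj A^Θ).left`, ON THE NOSE.
([IUTchI] Ex 3.2 (v) p.72) [claim: Mochizuki2012, status: disputed] -/
theorem cThetaToBirat_obj (X : T.CTheta d hq) :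
    (cThetaToBirat hC hF hq).obj X = (PreFrobenioid.toBirat C.toElem hF _).obj ⟨(T.dThetaIncl.obj X.base).left, 1⟩ := rfl

/-- `cThetaToBirat` on morphisms: Frobenius part, unit part (`q̲_v ↦ Θ̲_v`), pull-back part. ([IUTchI] Ex 3.2 (v) p.72)
[claim: Mochizuki2012, status: disputed] -/
theorem cThetaToBirat_map {X Y : T.CTheta d hq} (φ : X ⟶ Y) :
    (cThetaToBirat hC hF hq).map φ = frobB hF X.base (ModelFrobenioid.degFr φ) ≫
      unitB hC hF hq X.base (ModelFrobenioid.unit φ) ≫ pbB hF (ModelFrobenioid.baseMap φ) := rfl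

/-- **`thetaRestBiratData hC hF hq l : ThetaRestBiratData d T C hF hq`** — the four DATA fields of [IUTchI] Ex. 3.2 (ii)/(v) at a
carrier satisfying the decoupling spec: `Θ̲_v := theta hC hF` (the Θ̈-fraction in `𝒪^×(T^÷_{Ÿ_T})`), `l·ℤ := lZ hC l` («l·Aut_{𝒟_v}(Ÿ_T)»
— print's `l·ℤ` exactly when `Aut_{𝒟_v}(Ÿ_T) ≅ ℤ`; `l·ℤ × μ₂` for `Aut ≅ ℤ × μ₂`, `l` odd: the μ₂ rides along; FINITE/LABELLED
avatar, FOUNDATIONS 13 U2), the constants `constUnits hC hF` (GENUINE, via `T.proj`), and `cThetaToBirat hC hF hq`.  SIG-DELTA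
`(l : ℕ)` after `(hq)` (RULINGS #341 (B)).  GA-16 assembles `thetaRestBirat_of_carrierSpec` from it by `toRestBirat`.
([IUTchI] Ex 3.2 (ii) p.70) [claim: Mochizuki2012, status: disputed] -/
def thetaRestBiratData (l : ℕ) : ThetaRestBiratData d T C hF hq where
  theta := theta hC hF
  lZ := lZ hC l
  constUnits := constUnits hC hF
  CThetaToBirat := cThetaToBirat hC hF hq

/-- The data ON THE NOSE. ([IUTchI] Ex 3.2 (ii) p.70) [claim: Mochizuki2012, status: disputed] -/
theorem thetaRestBiratData_fields (l : ℕ) :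
    (thetaRestBiratData hC hF hq l).theta = theta hC hF ∧ (thetaRestBiratData hC hF hq l).lZ = lZ hC l ∧
      (thetaRestBiratData hC hF hq l).constUnits = constUnits hC hF ∧
      (thetaRestBiratData hC hF hq l).CThetaToBirat = cThetaToBirat hC hF hq :=
  ⟨rfl, rfl, rfl, rfl⟩

end Functor

end ArithThetaTower

end Literature.AnabelianGeometry.EtaleTheta

end
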